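import Literature.NumberTheory.Weil1965.AdelicFibreMeasures
import Literature.NumberTheory.Automorphic.AdelicHeightAffineLineLocal
import HarnessLib

/-!
# Splitting of the adelic Gauss coefficient `F*_Φ(ξ)` of a tensor `Φ = Φ_∞ ⊗ Φ_f` into archimedean × finite

Topic `NumberTheory/Weil1965`; namespace `Literature.NumberTheory.Weil1965`. KERNEL MATHEMATICS ONLY: proved theorems,
no definition, no named fact, no `sorry`.

For a number field `F`, `X = 𝔸_F^ι`, a map `h : X → 𝔸_F` which is COMPONENTWISE along `𝔸_F = F_∞ × 𝔸_F^∞` (as every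
polynomial map with coefficients in `F` is): `h(x) = (H_∞(x_∞), H_f(x_f))`, an additive Haar measure
`μ = c · (μ_E × μ_f) ∘ split⁻¹` on `X ≅ (F ⊗ ℝ)^ι × (𝔸_F^∞)^ι` (★ `exists_haar_eq_smul_map_prod`) and a factorizable
Schwartz–Bruhat function `Φ = Φ_∞ ⊗ Φ_f`, the coefficient of Weil's Siegel–Eisenstein measure
(`adelicSiegelCoeff`, [Weil1965, Chap. IV n° 41 p. 59]: `F*_Φ(ξ) = ∫_X ψ(ξ h(x)) Φ(x) dμ`) SPLITS:

  `F*_Φ(ξ) = c · G_∞(ξ) · G_f(ξ)`,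
  `G_∞(ξ) = ∫ ψ(ξ H_∞(y), 0) Φ_∞(y) dμ_E(y)`,  `G_f(ξ) = ∫ ψ_f(ξ H_f(z)) Φ_f(z) dμ_f(z)`

(`adelicSiegelCoeff_tensor_eq_mul`), because Tate's character splits, `ψ(a) = ψ(a_∞, 0) ψ_f(a_f)`
(★ `adeleAddChar_eq_mul`), and `∫ f(p₁) g(p₂) d(μ_E × μ_f) = (∫ f)(∫ g)`. The archimedean factor is the classical
oscillatory integral `∫ exp(−2πi Tr(ξ H_∞(y))) Φ_∞(y) dy` (★ `adeleAddChar_infiniteAdeleInl`,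
`adelicSiegelCoeff_tensor_eq_mul_fourierChar`). This is step (M1) of the height majorant
`|F*_Φ(ξ)| ≤ C(Φ) H(ξ)^{−N}` (Weil's condition (B), [Weil1965, Chap. I n° 2 Prop. 2; Chap. IV n° 40 Thm. 1, n° 41]) —
the local Gauss bounds (★ `LocalQuadraticGaussUnramified`, ★ `LocalQuadraticGaussTransformDecayMax`) are then applied
factor by factor and summed with ★ `summable_of_norm_le_mul_classicalHeight_rpow_neg`.

## References

* A. Weil, *Sur la formule de Siegel dans la théorie des groupes classiques*, Acta Math. 113 (1965): Chap. I n° 2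
  Prop. 2 p. 8; Chap. IV n° 40–41 pp. 57–59 [Weil1965].
* J. Tate, *Fourier analysis in number fields and Hecke's zeta-functions*, in Cassels–Fröhlich (1967), Ch. XV §2.2, §3.3,
  §4.1 (`ψ = Π ψ_v`, `dx = Π dx_v`) [CasselsFrohlichANT1967].
-/

noncomputable section

open MeasureTheory NumberField NumberField.InfinitePlace NumberField.mixedEmbedding IsDedekindDomain Filter
  Topology Set Literature.NumberTheory.Automorphic
open scoped Classical NNReal FourierTransform

namespace Literature.NumberTheory.Weil1965

variable (F : Type) [Field F] [NumberField F] (ι : Type) [Fintype ι]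
  [MeasurableSpace (adeleQuotient F)] [BorelSpace (adeleQuotient F)]
  [MeasurableSpace (AdeleRing (𝓞 F) F)] [BorelSpace (AdeleRing (𝓞 F) F)]
  [MeasurableSpace (FiniteAdeleRing (𝓞 F) F)] [BorelSpace (FiniteAdeleRing (𝓞 F) F)]

omit [MeasurableSpace (adeleQuotient F)] [BorelSpace (adeleQuotient F)] [MeasurableSpace (AdeleRing (𝓞 F) F)]
  [BorelSpace (AdeleRing (𝓞 F) F)] [MeasurableSpace (FiniteAdeleRing (𝓞 F) F)] [BorelSpace (FiniteAdeleRing (𝓞 F) F)]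
  [Fintype ι] in
/-- **The integrand of `F*_{Φ_∞ ⊗ Φ_f}(ξ)` read through the splitting is a tensor**: for `h` componentwise
(`(h x)_∞ = H_∞(x_∞)`, `(h x)_f = H_f(x_f)`), `ψ(ξ h(split p)) (Φ_∞ ⊗ Φ_f)(split p) = [ψ(ξ H_∞(p₁'), 0) Φ_∞(p₁)] · [ψ_f(ξ H_f(p₂)) Φ_f(p₂)]`
(`p₁' =` the `F_∞`-coordinates of `p₁`). [cite: CasselsFrohlichANT1967, Ch. XV (Tate), §4.1] -/
theorem adeleAddChar_mul_tensor_piAdeleSplit {h : (ι → AdeleRing (𝓞 F) F) → AdeleRing (𝓞 F) F}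
    (Hinf : (ι → InfiniteAdeleRing F) → InfiniteAdeleRing F)
    (Hfin : (ι → FiniteAdeleRing (𝓞 F) F) → FiniteAdeleRing (𝓞 F) F)
    (hh1 : ∀ x, (h x).1 = Hinf (fun i => (x i).1)) (hh2 : ∀ x, (h x).2 = Hfin (fun i => (x i).2))
    (Φinf : (ι → mixedSpace F) → ℂ) (Φfin : (ι → FiniteAdeleRing (𝓞 F) F) → ℂ) (ξ : F)
    (p : (ι → mixedSpace F) × (ι → FiniteAdeleRing (𝓞 F) F)) :
    (adeleAddChar F (algebraMap F (AdeleRing (𝓞 F) F) ξ * h (piAdeleSplit F ι p)) : ℂ) *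
        (Φinf (piArch F ι (piAdeleSplit F ι p)) * Φfin (piFinite F ι (piAdeleSplit F ι p))) =
      ((adeleAddChar F (infiniteAdeleInl F ((algebraMap F (AdeleRing (𝓞 F) F) ξ).1 *
          Hinf (fun i => (InfiniteAdeleRing.ringEquiv_mixedSpace F).symm (p.1 i)))) : ℂ) * Φinf p.1) *
      ((finiteAdeleAddChar F ((algebraMap F (AdeleRing (𝓞 F) F) ξ).2 * Hfin p.2) : ℂ) * Φfin p.2) := by
  rw [piArch_piAdeleSplit, piFinite_piAdeleSplit, adeleAddChar_eq_mul, Circle.coe_mul]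
  have h1 : (fun i => (piAdeleSplit F ι p i).1) =
      fun i => (InfiniteAdeleRing.ringEquiv_mixedSpace F).symm (p.1 i) := rfl
  have h2 : (fun i => (piAdeleSplit F ι p i).2) = p.2 := rfl
  have e1 : ∀ a b : AdeleRing (𝓞 F) F, (a * b).1 = a.1 * b.1 := fun _ _ => rfl
  have e2 : ∀ a b : AdeleRing (𝓞 F) F, (a * b).2 = a.2 * b.2 := fun _ _ => rfl
  rw [e1, e2, hh1, hh2, h1, h2]
  ring

omit [MeasurableSpace (adeleQuotient F)] [BorelSpace (adeleQuotient F)] in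
/-- **Splitting of the Siegel–Eisenstein coefficient of a tensor**: for `h` componentwise along `𝔸_F = F_∞ × 𝔸_F^∞`,
`μ = c · (μ_E × μ_f) ∘ split⁻¹` and `Φ = Φ_∞ ⊗ Φ_f`,
`F*_Φ(ξ) = c · (∫ ψ(ξ H_∞(y), 0) Φ_∞(y) dμ_E) · (∫ ψ_f(ξ H_f(z)) Φ_f(z) dμ_f)`.
[cite: Weil1965, Chap. IV n° 41, p. 59] -/
theorem adelicSiegelCoeff_tensor_eq_mul {μ : Measure (ι → AdeleRing (𝓞 F) F)}
    {μE : Measure (ι → mixedSpace F)} {μf : Measure (ι → FiniteAdeleRing (𝓞 F) F)} [SFinite μE] [SFinite μf]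
    {c : ℝ≥0}
    (hμ : μ = c • (μE.prod μf).map (piAdeleSplit F ι))
    {h : (ι → AdeleRing (𝓞 F) F) → AdeleRing (𝓞 F) F}
    (Hinf : (ι → InfiniteAdeleRing F) → InfiniteAdeleRing F)
    (Hfin : (ι → FiniteAdeleRing (𝓞 F) F) → FiniteAdeleRing (𝓞 F) F)
    (hh1 : ∀ x, (h x).1 = Hinf (fun i => (x i).1)) (hh2 : ∀ x, (h x).2 = Hfin (fun i => (x i).2))
    (Φinf : (ι → mixedSpace F) → ℂ) (Φfin : (ι → FiniteAdeleRing (𝓞 F) F) → ℂ) (ξ : F) :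
    adelicSiegelCoeff F ι μ h (fun v => Φinf (piArch F ι v) * Φfin (piFinite F ι v)) ξ =
      (c : ℂ) *
        ((∫ y, (adeleAddChar F (infiniteAdeleInl F ((algebraMap F (AdeleRing (𝓞 F) F) ξ).1 *
            Hinf (fun i => (InfiniteAdeleRing.ringEquiv_mixedSpace F).symm (y i)))) : ℂ) * Φinf y ∂μE) *
        (∫ z, (finiteAdeleAddChar F ((algebraMap F (AdeleRing (𝓞 F) F) ξ).2 * Hfin z) : ℂ) * Φfin z ∂μf)) := by
  haveI := secondCountableTopology_adeleRing (K := F)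
  haveI := secondCountableTopology_finiteAdeleRing (K := F)
  haveI : BorelSpace (ι → AdeleRing (𝓞 F) F) := Pi.borelSpace
  haveI : BorelSpace (ι → FiniteAdeleRing (𝓞 F) F) := Pi.borelSpace
  haveI : BorelSpace ((ι → mixedSpace F) × (ι → FiniteAdeleRing (𝓞 F) F)) := Prod.borelSpace
  have hme : MeasurableEmbedding (piAdeleSplit F ι) := (piAdeleSplit F ι).toHomeomorph.measurableEmbedding
  rw [adelicSiegelCoeff, hμ, integral_smul_nnreal_measure, hme.integral_map]
  simp only [adeleQuotChar_mk]
  simp_rw [adeleAddChar_mul_tensor_piAdeleSplit F ι Hinf Hfin hh1 hh2 Φinf Φfin ξ]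
  rw [integral_prod_mul (μ := μE) (ν := μf)
    (fun y : ι → mixedSpace F => (adeleAddChar F (infiniteAdeleInl F ((algebraMap F (AdeleRing (𝓞 F) F) ξ).1 *
      Hinf (fun i => (InfiniteAdeleRing.ringEquiv_mixedSpace F).symm (y i)))) : ℂ) * Φinf y)
    (fun z : ι → FiniteAdeleRing (𝓞 F) F =>
      (finiteAdeleAddChar F ((algebraMap F (AdeleRing (𝓞 F) F) ξ).2 * Hfin z) : ℂ) * Φfin z),
    NNReal.smul_def, Complex.real_smul]

omit [MeasurableSpace (adeleQuotient F)] [BorelSpace (adeleQuotient F)] in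
/-- The same splitting with the archimedean factor as a classical oscillatory integral,
`ψ(y, 0) = exp(−2πi Tr_{F_∞/ℝ}(y))` (★ `adeleAddChar_infiniteAdeleInl`):
`F*_Φ(ξ) = c · (∫ 𝐞(−Tr(ξ H_∞(y))) Φ_∞(y) dμ_E) · (∫ ψ_f(ξ H_f(z)) Φ_f(z) dμ_f)`.
[cite: Weil1965, Chap. IV n° 41, p. 59] -/
theorem adelicSiegelCoeff_tensor_eq_mul_fourierChar {μ : Measure (ι → AdeleRing (𝓞 F) F)}
    {μE : Measure (ι → mixedSpace F)} {μf : Measure (ι → FiniteAdeleRing (𝓞 F) F)} [SFinite μE] [SFinite μf]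
    {c : ℝ≥0}
    (hμ : μ = c • (μE.prod μf).map (piAdeleSplit F ι))
    {h : (ι → AdeleRing (𝓞 F) F) → AdeleRing (𝓞 F) F}
    (Hinf : (ι → InfiniteAdeleRing F) → InfiniteAdeleRing F)
    (Hfin : (ι → FiniteAdeleRing (𝓞 F) F) → FiniteAdeleRing (𝓞 F) F)
    (hh1 : ∀ x, (h x).1 = Hinf (fun i => (x i).1)) (hh2 : ∀ x, (h x).2 = Hfin (fun i => (x i).2))
    (Φinf : (ι → mixedSpace F) → ℂ) (Φfin : (ι → FiniteAdeleRing (𝓞 F) F) → ℂ) (ξ : F) :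
    adelicSiegelCoeff F ι μ h (fun v => Φinf (piArch F ι v) * Φfin (piFinite F ι v)) ξ =
      (c : ℂ) *
        ((∫ y, (𝐞 (-(infiniteAdeleTrace F ((algebraMap F (AdeleRing (𝓞 F) F) ξ).1 *
            Hinf (fun i => (InfiniteAdeleRing.ringEquiv_mixedSpace F).symm (y i))))) : ℂ) * Φinf y ∂μE) *
        (∫ z, (finiteAdeleAddChar F ((algebraMap F (AdeleRing (𝓞 F) F) ξ).2 * Hfin z) : ℂ) * Φfin z ∂μf)) := by
  rw [adelicSiegelCoeff_tensor_eq_mul F ι hμ Hinf Hfin hh1 hh2 Φinf Φfin ξ]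
  simp only [adeleAddChar_infiniteAdeleInl]

omit [MeasurableSpace (adeleQuotient F)] [BorelSpace (adeleQuotient F)] in
/-- **Norm form of the splitting**: `‖F*_Φ(ξ)‖ = c · ‖G_∞(ξ)‖ · ‖G_f(ξ)‖` — the shape in which local Gauss bounds
`‖G_v‖ ≤ C_v max(1,|ξ|_v)^{−N}` are multiplied into the height majorant of Weil's condition (B).
[cite: Weil1965, Chap. I n° 2, Prop. 2, p. 8] -/
theorem norm_adelicSiegelCoeff_tensor {μ : Measure (ι → AdeleRing (𝓞 F) F)}
    {μE : Measure (ι → mixedSpace F)} {μf : Measure (ι → FiniteAdeleRing (𝓞 F) F)} [SFinite μE] [SFinite μf]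
    {c : ℝ≥0}
    (hμ : μ = c • (μE.prod μf).map (piAdeleSplit F ι))
    {h : (ι → AdeleRing (𝓞 F) F) → AdeleRing (𝓞 F) F}
    (Hinf : (ι → InfiniteAdeleRing F) → InfiniteAdeleRing F)
    (Hfin : (ι → FiniteAdeleRing (𝓞 F) F) → FiniteAdeleRing (𝓞 F) F)
    (hh1 : ∀ x, (h x).1 = Hinf (fun i => (x i).1)) (hh2 : ∀ x, (h x).2 = Hfin (fun i => (x i).2))
    (Φinf : (ι → mixedSpace F) → ℂ) (Φfin : (ι → FiniteAdeleRing (𝓞 F) F) → ℂ) (ξ : F) :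
    ‖adelicSiegelCoeff F ι μ h (fun v => Φinf (piArch F ι v) * Φfin (piFinite F ι v)) ξ‖ =
      (c : ℝ) *
        (‖∫ y, (adeleAddChar F (infiniteAdeleInl F ((algebraMap F (AdeleRing (𝓞 F) F) ξ).1 *
            Hinf (fun i => (InfiniteAdeleRing.ringEquiv_mixedSpace F).symm (y i)))) : ℂ) * Φinf y ∂μE‖ *
        ‖∫ z, (finiteAdeleAddChar F ((algebraMap F (AdeleRing (𝓞 F) F) ξ).2 * Hfin z) : ℂ) * Φfin z ∂μf‖) := by
  rw [adelicSiegelCoeff_tensor_eq_mul F ι hμ Hinf Hfin hh1 hh2 Φinf Φfin ξ, norm_mul, norm_mul, Complex.norm_real,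
    Real.norm_eq_abs, NNReal.abs_eq]

omit [MeasurableSpace (adeleQuotient F)] [BorelSpace (adeleQuotient F)] [Fintype ι]
  [BorelSpace (AdeleRing (𝓞 F) F)] [MeasurableSpace (FiniteAdeleRing (𝓞 F) F)]
  [BorelSpace (FiniteAdeleRing (𝓞 F) F)] in
/-- **Condition (B) from a height majorant** (Weil's convergence, rank one, range `N > 2`): if
`‖F*_Φ(b)‖ ≤ C · H(b)^{−τ}` for all `b ∈ F` with the classical height
`H(b) = Π_{w∣∞} max(1,|b|_w)^{mult w} · Π_{v∤∞} max(1,|b|_v)` and `τ > 2`, then `Σ_b ‖F*_Φ(b)‖ < ∞`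
(★ `summable_of_norm_le_mul_classicalHeight_rpow_neg`). [cite: Weil1965, Chap. IV n° 40, Thm. 1, p. 57] -/
theorem summable_norm_adelicSiegelCoeff_of_le_classicalHeight {μ : Measure (ι → AdeleRing (𝓞 F) F)}
    {h : (ι → AdeleRing (𝓞 F) F) → AdeleRing (𝓞 F) F} {Φ : (ι → AdeleRing (𝓞 F) F) → ℂ} {τ : ℝ} (hτ : 2 < τ)
    (C : ℝ)
    (hC : ∀ b : F, ‖adelicSiegelCoeff F ι μ h Φ b‖ ≤ C *
      ((((∏ w : InfinitePlace F, (max 1 ‖((b : F) : w.Completion)‖₊) ^ w.mult) *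
        ∏ᶠ v : HeightOneSpectrum (𝓞 F), max 1 ‖((b : F) : v.adicCompletion F)‖₊ : ℝ≥0) : ℝ)) ^ (-τ)) :
    Summable fun b : F => ‖adelicSiegelCoeff F ι μ h Φ b‖ :=
  (summable_of_norm_le_mul_classicalHeight_rpow_neg F hτ C (fun b => adelicSiegelCoeff F ι μ h Φ b) hC).1.norm

end Literature.NumberTheory.Weil1965
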